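import Summits.Ventures.HodgeRepro.Night1AndreOrbits
import Summits.Ventures.HodgeRepro.Night1ProductWeilRational

/-!
# S3 with the `ℚ`-structure: the pull-backs of the RATIONAL Weil classes — `f_Δ^*(f · (v₁ ∧_F ⋯ ∧_F v_{2p}))`
is the «rational Pohlmann class» `Σ_g φ₀(g f) e_{g • Δ}`, these span the orbit piece over `ℂ`, and for a
free orbit `f ↦ f_Δ^*(ratWeil f)` is an injective `ℚ`-linear map `F → H^{2p}(A) ⊗ ℂ` (a `ℚ`-form of the piece)

Blind re-derivation cell `pub-hodge-repro`, seat `night-1` (gen 6).  Imports night-1's `Night1AndreOrbits`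
(the pull-back `andrePull`, `andrePull_weilWedgeProd`, the dual functionals `setDual`) and gen 4's
`Night1ProductWeilRational` (p379826: the rational Weil classes `ratWeil φ₀ e f = Σ_g φ₀(g f) • e_g` of the
corner product of a Galois CM field `K`, `G = Gal(K/ℚ) = K ≃ₐ[ℚ] K`, base embedding `φ₀`; `span_ratWeil`,
`ratWeil_add` / `ratWeil_smul`).  Namespace `HodgeRepro.RouteC`.

Milne 2020 Theorem 1 (store `paper:arxiv-2010.08857` p0005:L5–8) is a statement about RATIONAL classes:
«every Hodge class `t` on `A` can be written as a sum `t = Σ f_Δ^*(t_Δ)` with `t_Δ` a Weil class on `A_Δ`».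
Gen 4 modelled the `ℚ`-structure of `W_F(A_Δ)` as the image of `f ↦ ratWeil f`; this file pushes it through
`f_Δ^*`:

* `ratPohlmann φ₀ Δ e f = Σ_g φ₀(g f) • e_{g • Δ}` (the `g`-th wedge enumerated through `e`);
  **`andrePull_ratWeil`** — `f_Δ^*(ratWeil f) = ratPohlmann f`; `ratPohlmann_add` / `ratPohlmann_smul`
  (`ℚ`-linear in `f`);
* **`span_ratPohlmann`** — the rational Pohlmann classes span `f_Δ^*(W_F(A_Δ)) ⊗ ℂ` over `ℂ`;
* `setDual_ratPohlmann` — for a FREE orbit (`g ↦ g • Δ` injective, i.e. trivial stabiliser) the coefficient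
  of `e_{g • Δ}` in `ratPohlmann f` is `φ₀(g f)`; **`ratPohlmann_injective`** — then `f ↦ ratPohlmann f` is
  injective: `F → f_Δ^*(W_F(A_Δ)) ⊗ ℂ` is an injective `ℚ`-linear map whose `ℂ`-span is the whole piece — a
  `ℚ`-form of dimension `[F : ℚ] = |G| = |G • Δ|` (`finrank_map_andrePull_weilSpaceProd`).

For a non-free orbit the map `f ↦ ratPohlmann f` factors through the sign-twisted trace to the fixed
field of the stabiliser (the enumerations of `g • Δ` for `g` in a coset differ by the permutation the
stabiliser induces on `Δ`); that bookkeeping is left to a successor.  Nothing geometric is built.  Nothing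
here says anything about the status of the Hodge conjecture for CM abelian varieties, which is NOT proved.
-/

set_option autoImplicit false

open Finset Module
open scoped Pointwise Classical

namespace HodgeRepro.RouteC

open CMHodge CMHodgeOn

variable (K : Type*) [Field K] [NumberField K] [IsGalois ℚ K] (φ₀ : K →+* ℂ)
variable {X : Type*} [MulAction (K ≃ₐ[ℚ] K) X] [Fintype X] [DecidableEq X]

/-- **The rational Pohlmann class of `f ∈ K`** attached to `Δ`: `Σ_g φ₀(g f) • e_{g • Δ}` — the pull-back
`f_Δ^*` of the rational Weil class `f · (v₁ ∧_K ⋯ ∧_K v_{2p})` of `A_Δ`. -/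
noncomputable def ratPohlmann {p : ℕ} (Δ : Finset X) (e : Fin (2 * p) ≃ ↥Δ) (f : K) :
    ⋀[ℂ]^(2 * p) (X → ℂ) :=
  ∑ g : K ≃ₐ[ℚ] K, φ₀ (g f) • coordWedgeOn (2 * p) (deltaEnum Δ e g)

omit [IsGalois ℚ K] [Fintype X] in
/-- **`f_Δ^*` carries the rational Weil class of `f` to the rational Pohlmann class of `f`.** -/
theorem andrePull_ratWeil {p : ℕ} (Δ : Finset X) (e : Fin (2 * p) ≃ ↥Δ) (f : K) :
    andrePull Δ (2 * p) (ratWeil K φ₀ e f) = ratPohlmann K φ₀ Δ e f := by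
  unfold ratWeil ratPohlmann
  rw [map_sum]
  simp only [map_smul, andrePull_weilWedgeProd]

omit [IsGalois ℚ K] [Fintype X] in
/-- `ratPohlmann` is additive in `f`. -/
theorem ratPohlmann_add {p : ℕ} (Δ : Finset X) (e : Fin (2 * p) ≃ ↥Δ) (f f' : K) :
    ratPohlmann K φ₀ Δ e (f + f') = ratPohlmann K φ₀ Δ e f + ratPohlmann K φ₀ Δ e f' := by
  rw [← andrePull_ratWeil, ← andrePull_ratWeil, ← andrePull_ratWeil, ← map_add, ratWeil_add]

omit [IsGalois ℚ K] [Fintype X] in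
/-- `ratPohlmann` is `ℚ`-homogeneous in `f`. -/
theorem ratPohlmann_smul {p : ℕ} (Δ : Finset X) (e : Fin (2 * p) ≃ ↥Δ) (q : ℚ) (f : K) :
    ratPohlmann K φ₀ Δ e (q • f) = (q : ℂ) • ratPohlmann K φ₀ Δ e f := by
  rw [← andrePull_ratWeil, ← andrePull_ratWeil, ratWeil_smul, map_smul]

omit [Fintype X] in
/-- **The rational Pohlmann classes span the pulled-back Weil space over `ℂ`.** -/
theorem span_ratPohlmann {p : ℕ} (Δ : Finset X) (e : Fin (2 * p) ≃ ↥Δ) :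
    Submodule.span ℂ (Set.range (ratPohlmann K φ₀ Δ e)) =
      (weilSpaceProd (K ≃ₐ[ℚ] K) p e).map (andrePull Δ (2 * p)) := by
  rw [← span_ratWeil K φ₀ e, Submodule.map_span]
  congr 1
  ext ω
  constructor
  · rintro ⟨f, rfl⟩
    exact ⟨ratWeil K φ₀ e f, ⟨f, rfl⟩, andrePull_ratWeil K φ₀ Δ e f⟩
  · rintro ⟨_, ⟨f, rfl⟩, rfl⟩
    exact ⟨f, (andrePull_ratWeil K φ₀ Δ e f).symm⟩

omit [IsGalois ℚ K] [Fintype X] in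
/-- For a free orbit, the coefficient of `e_{g₀ • Δ}` in the rational Pohlmann class of `f` is `φ₀(g₀ f)`. -/
theorem setDual_ratPohlmann {p : ℕ} (Δ : Finset X) (e : Fin (2 * p) ≃ ↥Δ)
    (hfree : Function.Injective fun g : K ≃ₐ[ℚ] K => g • Δ) (f : K) (g₀ : K ≃ₐ[ℚ] K) :
    setDual (deltaEnum Δ e g₀) (ratPohlmann K φ₀ Δ e f) = φ₀ (g₀ f) := by
  rw [ratPohlmann, map_sum, Finset.sum_eq_single g₀]
  · rw [map_smul, setDual_coordWedgeOn_self (deltaEnum_injective Δ e g₀), smul_eq_mul, mul_one]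
  · intro g _ hg
    rw [map_smul, setDual_coordWedgeOn_of_image_ne (deltaEnum_injective Δ e g₀) (deltaEnum_injective Δ e g)
      (by rw [image_deltaEnum, image_deltaEnum]; exact fun h => hg (hfree h).symm), smul_zero]
  · intro h
    exact absurd (Finset.mem_univ g₀) h

omit [IsGalois ℚ K] [Fintype X] in
/-- **For a free orbit, `f ↦ ratPohlmann f` is injective**: with `span_ratPohlmann`, the rational Pohlmann
classes are a `ℚ`-form of `f_Δ^*(W_F(A_Δ)) ⊗ ℂ` of `ℚ`-dimension `[K : ℚ]`. -/
theorem ratPohlmann_injective {p : ℕ} (Δ : Finset X) (e : Fin (2 * p) ≃ ↥Δ)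
    (hfree : Function.Injective fun g : K ≃ₐ[ℚ] K => g • Δ) :
    Function.Injective (ratPohlmann K φ₀ Δ e) := by
  intro f f' h
  have := congrArg (setDual (deltaEnum Δ e (1 : K ≃ₐ[ℚ] K))) h
  rw [setDual_ratPohlmann K φ₀ Δ e hfree, setDual_ratPohlmann K φ₀ Δ e hfree, AlgEquiv.one_apply,
    AlgEquiv.one_apply] at this
  exact φ₀.injective this

end HodgeRepro.RouteC
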